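import Mathlib
import Summits.AtomisticToContinuum.FouriersLaw.Theorems.EmbeddedDrudeMourreDrudeDissolutionCutoffs
import HarnessLib

/-!
# Products of scaled cutoffs and squared distances: the calculus of the cutoff family
(crux `EmbeddedDrudeMourre.DrudeDissolution`, item stmt-AtomisticToContinuum-12593; `--supports` file for the
registered sub-goal `cutoff_product_bounds` of stub B1b″ `stub_excursionSecondDifference` of line
`kinetic-polymer-gas-on-the-time-axis`; closes nothing; lead c13 (process B), 2026-08-17)

WHAT. Three generic pieces of calculus on a real normed space, along fixed directions `e, e'`:
* `fp_mul2` — the second-derivative product rule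
  `∂ₑ'∂ₑ(uw) = ∂ₑ'∂ₑu·w + ∂ₑu·∂ₑ'w + ∂ₑ'u·∂ₑw + u·∂ₑ'∂ₑw` (for `u, w ∈ C²`);
* `cutoff_product_bounds` (registered, explicit binders on `ℝ³`; general version
  `cutoff_product_bounds_gen`) — if `Θ₁, Θ₂ ∈ C²` take values in `[0,1]` with `|∂Θᵢ| ≤ aᵢ/η`,
  `|∂∂Θᵢ| ≤ bᵢ/η²` (both directions) then `Θ₁Θ₂ ∈ C²` takes values in `[0,1]` with
  `|∂(Θ₁Θ₂)| ≤ (a₁+a₂)/η`, `|∂∂(Θ₁Θ₂)| ≤ (b₁ + 2a₁a₂ + b₂)/η²` — so the five-fold product cutoff of the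
  sup-norm route inherits `O(η⁻¹)`, `O(η⁻²)` bounds by four applications;
* `sqDist_bounds` — for `ρ = u² + w²` with `|u|,|w| ≤ U₀`, `|∂u|,|∂w| ≤ U₁`, `|∂∂u|,|∂∂w| ≤ U₂`:
  `0 ≤ ρ`, `(∂ρ)² ≤ 8U₁²·ρ` and `|∂∂ρ| ≤ 4(U₁² + U₀U₂)` — the "squared distance" hypotheses of
  `cutoff_scale_bounds_gen` for `ρ ∈ {S₁²+A², S₂²+A², S₁²+S₂²}`;
* `cutoff_vanishes_near` — `ζ(ρ/η²) = 0` on a neighbourhood of any point where `ρ < η²`.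

WHY (role). Items (C3) and part of (C6) of the remaining concrete work for B1b″ (NOTES, lead c13): the
cutoff family `Θ_η = Π_k ζ(ρ_k/η²)` is `C²`, `[0,1]`-valued, `≡ 0` near the critical set, with derivative
bounds `O(η⁻¹)`, `O(η⁻²)` feeding `g₁, g₂` of `flux_pointwise_bound`.
-/

noncomputable section

open Set Filter Function Topology
open scoped Topology

namespace Summit.AtomisticToContinuum.FouriersLaw.Theorems.DrudeDissolution.KineticPolymerGasOnTheTimeAxis

variable {V : Type*} [NormedAddCommGroup V] [NormedSpace ℝ V]

/-! ### §1 The second-derivative product rule -/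

/-- **Second-derivative product rule along two directions.** For `u, w ∈ C²`:
`∂ₑ'∂ₑ(uw)(p) = ∂ₑ'∂ₑu·w + ∂ₑu·∂ₑ'w + ∂ₑ'u·∂ₑw + u·∂ₑ'∂ₑw` (all at `p`). [folklore] -/
theorem fp_mul2 {u w : V → ℝ} (hu : ContDiff ℝ 2 u) (hw : ContDiff ℝ 2 w) (p e e' : V) :
    fderiv ℝ (fun q => fderiv ℝ (fun r => u r * w r) q e) p e' =
      fderiv ℝ (fun q => fderiv ℝ u q e) p e' * w p + fderiv ℝ u p e * fderiv ℝ w p e' +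
        fderiv ℝ u p e' * fderiv ℝ w p e + u p * fderiv ℝ (fun q => fderiv ℝ w q e) p e' := by
  have hud : Differentiable ℝ u := hu.differentiable (by norm_num)
  have hwd : Differentiable ℝ w := hw.differentiable (by norm_num)
  have hfun : (fun q => fderiv ℝ (fun r => u r * w r) q e) =
      fun q => fderiv ℝ u q e * w q + u q * fderiv ℝ w q e :=
    funext fun q => fp_mul (hud q) (hwd q) e
  rw [hfun]
  have hue : DifferentiableAt ℝ (fun q => fderiv ℝ u q e) p :=
    (((hu.fderiv_right (m := 1) (by norm_num)).differentiable one_ne_zero) p).clm_apply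
      (differentiableAt_const e)
  have hwe : DifferentiableAt ℝ (fun q => fderiv ℝ w q e) p :=
    (((hw.fderiv_right (m := 1) (by norm_num)).differentiable one_ne_zero) p).clm_apply
      (differentiableAt_const e)
  have hA : DifferentiableAt ℝ (fun q => fderiv ℝ u q e * w q) p := hue.mul (hwd p)
  have hB : DifferentiableAt ℝ (fun q => u q * fderiv ℝ w q e) p := (hud p).mul hwe
  rw [fderiv_fun_add hA hB, add_apply, fp_mul hue (hwd p), fp_mul (hud p) hwe]
  ring

/-! ### §2 Products of `[0,1]`-valued cutoffs with scaled derivative bounds -/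

/-- **Product of two cutoffs (general normed space).** [folklore] -/
theorem cutoff_product_bounds_gen {Θ₁ Θ₂ : V → ℝ} (h₁ : ContDiff ℝ 2 Θ₁) (h₂ : ContDiff ℝ 2 Θ₂)
    (h₁01 : ∀ q, 0 ≤ Θ₁ q ∧ Θ₁ q ≤ 1) (h₂01 : ∀ q, 0 ≤ Θ₂ q ∧ Θ₂ q ≤ 1) {η a₁ a₂ b₁ b₂ : ℝ} (hη : 0 < η)
    (p e e' : V)
    (ha₁ : |fderiv ℝ Θ₁ p e| ≤ a₁ / η) (ha₁' : |fderiv ℝ Θ₁ p e'| ≤ a₁ / η)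
    (ha₂ : |fderiv ℝ Θ₂ p e| ≤ a₂ / η) (ha₂' : |fderiv ℝ Θ₂ p e'| ≤ a₂ / η)
    (hb₁ : |fderiv ℝ (fun q => fderiv ℝ Θ₁ q e) p e'| ≤ b₁ / η ^ 2)
    (hb₂ : |fderiv ℝ (fun q => fderiv ℝ Θ₂ q e) p e'| ≤ b₂ / η ^ 2) :
    ContDiff ℝ 2 (fun q => Θ₁ q * Θ₂ q) ∧ (0 ≤ Θ₁ p * Θ₂ p ∧ Θ₁ p * Θ₂ p ≤ 1) ∧
      |fderiv ℝ (fun q => Θ₁ q * Θ₂ q) p e| ≤ (a₁ + a₂) / η ∧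
      |fderiv ℝ (fun q => fderiv ℝ (fun r => Θ₁ r * Θ₂ r) q e) p e'| ≤ (b₁ + 2 * a₁ * a₂ + b₂) / η ^ 2 := by
  have hd₁ : Differentiable ℝ Θ₁ := h₁.differentiable (by norm_num)
  have hd₂ : Differentiable ℝ Θ₂ := h₂.differentiable (by norm_num)
  have ha₁0 : 0 ≤ a₁ / η := (abs_nonneg _).trans ha₁
  have ha₂0 : 0 ≤ a₂ / η := (abs_nonneg _).trans ha₂
  refine ⟨h₁.mul h₂, ⟨mul_nonneg (h₁01 p).1 (h₂01 p).1, ?_⟩, ?_, ?_⟩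
  · calc Θ₁ p * Θ₂ p ≤ 1 * 1 := mul_le_mul (h₁01 p).2 (h₂01 p).2 (h₂01 p).1 zero_le_one
      _ = 1 := one_mul _
  · rw [fp_mul (hd₁ p) (hd₂ p)]
    calc |fderiv ℝ Θ₁ p e * Θ₂ p + Θ₁ p * fderiv ℝ Θ₂ p e|
        ≤ |fderiv ℝ Θ₁ p e * Θ₂ p| + |Θ₁ p * fderiv ℝ Θ₂ p e| := abs_add_le _ _
      _ = |fderiv ℝ Θ₁ p e| * Θ₂ p + Θ₁ p * |fderiv ℝ Θ₂ p e| := by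
          rw [abs_mul, abs_mul, abs_of_nonneg (h₂01 p).1, abs_of_nonneg (h₁01 p).1]
      _ ≤ a₁ / η * 1 + 1 * (a₂ / η) :=
          add_le_add (mul_le_mul ha₁ (h₂01 p).2 (h₂01 p).1 ha₁0)
            (mul_le_mul (h₁01 p).2 ha₂ (abs_nonneg _) zero_le_one)
      _ = (a₁ + a₂) / η := by ring
  · rw [fp_mul2 h₁ h₂ p e e']
    have hb₁0 : 0 ≤ b₁ / η ^ 2 := (abs_nonneg _).trans hb₁
    calc |fderiv ℝ (fun q => fderiv ℝ Θ₁ q e) p e' * Θ₂ p + fderiv ℝ Θ₁ p e * fderiv ℝ Θ₂ p e' +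
          fderiv ℝ Θ₁ p e' * fderiv ℝ Θ₂ p e + Θ₁ p * fderiv ℝ (fun q => fderiv ℝ Θ₂ q e) p e'|
        ≤ |fderiv ℝ (fun q => fderiv ℝ Θ₁ q e) p e' * Θ₂ p| + |fderiv ℝ Θ₁ p e * fderiv ℝ Θ₂ p e'| +
          |fderiv ℝ Θ₁ p e' * fderiv ℝ Θ₂ p e| + |Θ₁ p * fderiv ℝ (fun q => fderiv ℝ Θ₂ q e) p e'| := by
          refine (abs_add_le _ _).trans (add_le_add ((abs_add_le _ _).trans (add_le_add (abs_add_le _ _) le_rfl)) le_rfl)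
      _ ≤ b₁ / η ^ 2 * 1 + a₁ / η * (a₂ / η) + a₁ / η * (a₂ / η) + 1 * (b₂ / η ^ 2) := by
          rw [abs_mul, abs_mul, abs_mul, abs_mul, abs_of_nonneg (h₂01 p).1, abs_of_nonneg (h₁01 p).1]
          exact add_le_add (add_le_add (add_le_add (mul_le_mul hb₁ (h₂01 p).2 (h₂01 p).1 hb₁0)
            (mul_le_mul ha₁ ha₂' (abs_nonneg _) ha₁0)) (mul_le_mul ha₁' ha₂ (abs_nonneg _) ha₁0))
            (mul_le_mul (h₁01 p).2 hb₂ (abs_nonneg _) zero_le_one)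
      _ = (b₁ + 2 * a₁ * a₂ + b₂) / η ^ 2 := by field_simp; ring

/-- **Product of two cutoffs on `ℝ³` (registered sub-goal `cutoff_product_bounds` of stub B1b″; all binders
explicit).** If `Θ₁, Θ₂ ∈ C²` take values in `[0,1]` and at `p`, along `e, e'`, `|∂Θᵢ| ≤ aᵢ/η`,
`|∂ₑ'∂ₑΘᵢ| ≤ bᵢ/η²`, then `Θ₁Θ₂ ∈ C²`, `0 ≤ Θ₁Θ₂ ≤ 1`, `|∂ₑ(Θ₁Θ₂)(p)| ≤ (a₁+a₂)/η` and
`|∂ₑ'∂ₑ(Θ₁Θ₂)(p)| ≤ (b₁+2a₁a₂+b₂)/η²`. [folklore] -/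
theorem cutoff_product_bounds :
    ∀ (Θ₁ Θ₂ : ℝ × ℝ × ℝ → ℝ) (p e e' : ℝ × ℝ × ℝ) (η a₁ a₂ b₁ b₂ : ℝ), ContDiff ℝ 2 Θ₁ → ContDiff ℝ 2 Θ₂ →
      (∀ q, 0 ≤ Θ₁ q ∧ Θ₁ q ≤ 1) → (∀ q, 0 ≤ Θ₂ q ∧ Θ₂ q ≤ 1) → 0 < η →
      |fderiv ℝ Θ₁ p e| ≤ a₁ / η → |fderiv ℝ Θ₁ p e'| ≤ a₁ / η →
      |fderiv ℝ Θ₂ p e| ≤ a₂ / η → |fderiv ℝ Θ₂ p e'| ≤ a₂ / η →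
      |fderiv ℝ (fun q => fderiv ℝ Θ₁ q e) p e'| ≤ b₁ / η ^ 2 →
      |fderiv ℝ (fun q => fderiv ℝ Θ₂ q e) p e'| ≤ b₂ / η ^ 2 →
      ContDiff ℝ 2 (fun q => Θ₁ q * Θ₂ q) ∧ (0 ≤ Θ₁ p * Θ₂ p ∧ Θ₁ p * Θ₂ p ≤ 1) ∧
        |fderiv ℝ (fun q => Θ₁ q * Θ₂ q) p e| ≤ (a₁ + a₂) / η ∧
        |fderiv ℝ (fun q => fderiv ℝ (fun r => Θ₁ r * Θ₂ r) q e) p e'| ≤ (b₁ + 2 * a₁ * a₂ + b₂) / η ^ 2 :=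
  fun _ _ p e e' _ _ _ _ _ h₁ h₂ h₁01 h₂01 hη ha₁ ha₁' ha₂ ha₂' hb₁ hb₂ =>
    cutoff_product_bounds_gen h₁ h₂ h₁01 h₂01 hη p e e' ha₁ ha₁' ha₂ ha₂' hb₁ hb₂

/-! ### §3 Squared distances `ρ = u² + w²` -/

/-- **Squared-distance bounds.** For `u, w ∈ C²` with `|u p|,|w p| ≤ U₀`, `|∂u p|,|∂w p| ≤ U₁` (both
directions), `|∂ₑ'∂ₑu p|,|∂ₑ'∂ₑw p| ≤ U₂`: `ρ = u² + w²` satisfies `0 ≤ ρ p`, `(∂ₑρ p)² ≤ 8U₁²·ρ p` and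
`|∂ₑ'∂ₑρ p| ≤ 4(U₁² + U₀U₂)`. [folklore] -/
theorem sqDist_bounds {u w : V → ℝ} (hu : ContDiff ℝ 2 u) (hw : ContDiff ℝ 2 w) (p e e' : V)
    {U₀ U₁ U₂ : ℝ} (hu0 : |u p| ≤ U₀) (hw0 : |w p| ≤ U₀)
    (hu1 : |fderiv ℝ u p e| ≤ U₁) (hu1' : |fderiv ℝ u p e'| ≤ U₁)
    (hw1 : |fderiv ℝ w p e| ≤ U₁) (hw1' : |fderiv ℝ w p e'| ≤ U₁)
    (hu2 : |fderiv ℝ (fun q => fderiv ℝ u q e) p e'| ≤ U₂)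
    (hw2 : |fderiv ℝ (fun q => fderiv ℝ w q e) p e'| ≤ U₂) :
    0 ≤ u p ^ 2 + w p ^ 2 ∧
      (fderiv ℝ (fun q => u q ^ 2 + w q ^ 2) p e) ^ 2 ≤ 8 * U₁ ^ 2 * (u p ^ 2 + w p ^ 2) ∧
      |fderiv ℝ (fun q => fderiv ℝ (fun r => u r ^ 2 + w r ^ 2) q e) p e'| ≤ 4 * (U₁ ^ 2 + U₀ * U₂) := by
  have hud : Differentiable ℝ u := hu.differentiable (by norm_num)
  have hwd : Differentiable ℝ w := hw.differentiable (by norm_num)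
  have hU₀ : 0 ≤ U₀ := (abs_nonneg _).trans hu0
  have hU₁ : 0 ≤ U₁ := (abs_nonneg _).trans hu1
  have hU₂ : 0 ≤ U₂ := (abs_nonneg _).trans hu2
  -- first derivative everywhere
  have hfirst : ∀ q v, fderiv ℝ (fun q => u q ^ 2 + w q ^ 2) q v =
      2 * u q * fderiv ℝ u q v + 2 * w q * fderiv ℝ w q v := by
    intro q v
    have h1 : DifferentiableAt ℝ (fun q => u q ^ 2) q := (hud q).pow 2
    have h2 : DifferentiableAt ℝ (fun q => w q ^ 2) q := (hwd q).pow 2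
    rw [fderiv_fun_add h1 h2, add_apply, fp_sq (hud q), fp_sq (hwd q)]
  refine ⟨by positivity, ?_, ?_⟩
  · rw [hfirst]
    -- `(2u u' + 2w w')² ≤ 4(u²+w²)(u'²+w'²) ≤ 8U₁²(u²+w²)`
    have hcs : (2 * u p * fderiv ℝ u p e + 2 * w p * fderiv ℝ w p e) ^ 2 ≤
        4 * (u p ^ 2 + w p ^ 2) * ((fderiv ℝ u p e) ^ 2 + (fderiv ℝ w p e) ^ 2) := by
      nlinarith [sq_nonneg (u p * fderiv ℝ w p e - w p * fderiv ℝ u p e)]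
    have hder : (fderiv ℝ u p e) ^ 2 + (fderiv ℝ w p e) ^ 2 ≤ 2 * U₁ ^ 2 := by
      have h1 : (fderiv ℝ u p e) ^ 2 ≤ U₁ ^ 2 := by
        rw [← sq_abs]; exact pow_le_pow_left₀ (abs_nonneg _) hu1 2
      have h2 : (fderiv ℝ w p e) ^ 2 ≤ U₁ ^ 2 := by
        rw [← sq_abs]; exact pow_le_pow_left₀ (abs_nonneg _) hw1 2
      linarith
    calc (2 * u p * fderiv ℝ u p e + 2 * w p * fderiv ℝ w p e) ^ 2
        ≤ 4 * (u p ^ 2 + w p ^ 2) * ((fderiv ℝ u p e) ^ 2 + (fderiv ℝ w p e) ^ 2) := hcs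
      _ ≤ 4 * (u p ^ 2 + w p ^ 2) * (2 * U₁ ^ 2) := by gcongr
      _ = 8 * U₁ ^ 2 * (u p ^ 2 + w p ^ 2) := by ring
  · -- second derivative: differentiate `q ↦ 2u ∂u + 2w ∂w`
    have hfun : (fun q => fderiv ℝ (fun r => u r ^ 2 + w r ^ 2) q e) =
        fun q => 2 * u q * fderiv ℝ u q e + 2 * w q * fderiv ℝ w q e := funext fun q => hfirst q e
    rw [hfun]
    have hue : DifferentiableAt ℝ (fun q => fderiv ℝ u q e) p :=
      (((hu.fderiv_right (m := 1) (by norm_num)).differentiable one_ne_zero) p).clm_apply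
        (differentiableAt_const e)
    have hwe : DifferentiableAt ℝ (fun q => fderiv ℝ w q e) p :=
      (((hw.fderiv_right (m := 1) (by norm_num)).differentiable one_ne_zero) p).clm_apply
        (differentiableAt_const e)
    have h2u : DifferentiableAt ℝ (fun q => 2 * u q) p := (hud p).const_mul 2
    have h2w : DifferentiableAt ℝ (fun q => 2 * w q) p := (hwd p).const_mul 2
    have hA : DifferentiableAt ℝ (fun q => 2 * u q * fderiv ℝ u q e) p := h2u.mul hue
    have hB : DifferentiableAt ℝ (fun q => 2 * w q * fderiv ℝ w q e) p := h2w.mul hwe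
    rw [fderiv_fun_add hA hB, add_apply, fp_mul h2u hue, fp_mul h2w hwe]
    have h2u' : fderiv ℝ (fun q => 2 * u q) p e' = 2 * fderiv ℝ u p e' := by
      rw [fp_mul (differentiableAt_const _) (hud p)]; simp
    have h2w' : fderiv ℝ (fun q => 2 * w q) p e' = 2 * fderiv ℝ w p e' := by
      rw [fp_mul (differentiableAt_const _) (hwd p)]; simp
    rw [h2u', h2w']
    have t1 : |2 * fderiv ℝ u p e' * fderiv ℝ u p e| ≤ 2 * U₁ ^ 2 := by
      rw [abs_mul, abs_mul, abs_two]
      nlinarith [abs_nonneg (fderiv ℝ u p e'), abs_nonneg (fderiv ℝ u p e)]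
    have t2 : |2 * u p * fderiv ℝ (fun q => fderiv ℝ u q e) p e'| ≤ 2 * (U₀ * U₂) := by
      rw [abs_mul, abs_mul, abs_two]
      nlinarith [abs_nonneg (u p), abs_nonneg (fderiv ℝ (fun q => fderiv ℝ u q e) p e')]
    have t3 : |2 * fderiv ℝ w p e' * fderiv ℝ w p e| ≤ 2 * U₁ ^ 2 := by
      rw [abs_mul, abs_mul, abs_two]
      nlinarith [abs_nonneg (fderiv ℝ w p e'), abs_nonneg (fderiv ℝ w p e)]
    have t4 : |2 * w p * fderiv ℝ (fun q => fderiv ℝ w q e) p e'| ≤ 2 * (U₀ * U₂) := by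
      rw [abs_mul, abs_mul, abs_two]
      nlinarith [abs_nonneg (w p), abs_nonneg (fderiv ℝ (fun q => fderiv ℝ w q e) p e')]
    calc |2 * fderiv ℝ u p e' * fderiv ℝ u p e + 2 * u p * fderiv ℝ (fun q => fderiv ℝ u q e) p e' +
          (2 * fderiv ℝ w p e' * fderiv ℝ w p e + 2 * w p * fderiv ℝ (fun q => fderiv ℝ w q e) p e')|
        ≤ (|2 * fderiv ℝ u p e' * fderiv ℝ u p e| + |2 * u p * fderiv ℝ (fun q => fderiv ℝ u q e) p e'|) +
          (|2 * fderiv ℝ w p e' * fderiv ℝ w p e| + |2 * w p * fderiv ℝ (fun q => fderiv ℝ w q e) p e'|) :=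
          (abs_add_le _ _).trans (add_le_add (abs_add_le _ _) (abs_add_le _ _))
      _ ≤ (2 * U₁ ^ 2 + 2 * (U₀ * U₂)) + (2 * U₁ ^ 2 + 2 * (U₀ * U₂)) := by gcongr
      _ = 4 * (U₁ ^ 2 + U₀ * U₂) := by ring

/-! ### §4 The cutoff vanishes near points of its null zone -/

omit [NormedSpace ℝ V] in
/-- **`ζ(ρ/η²) = 0` near any point where `ρ < η²`** (for a profile vanishing on `(−∞,1]` and a continuous
`ρ`). [folklore] -/
theorem cutoff_vanishes_near {ζ : ℝ → ℝ} (hζ0 : ∀ t, t ≤ 1 → ζ t = 0) {ρ : V → ℝ} (hρ : Continuous ρ)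
    {η : ℝ} (hη : 0 < η) {p : V} (hp : ρ p < η ^ 2) :
    (fun q => ζ (ρ q / η ^ 2)) =ᶠ[𝓝 p] 0 := by
  have hη2 : 0 < η ^ 2 := pow_pos hη 2
  have hopen : ∀ᶠ q in 𝓝 p, ρ q < η ^ 2 := hρ.continuousAt.eventually_lt continuousAt_const hp
  filter_upwards [hopen] with q hq
  exact hζ0 _ ((div_le_one hη2).2 hq.le)

end Summit.AtomisticToContinuum.FouriersLaw.Theorems.DrudeDissolution.KineticPolymerGasOnTheTimeAxis

end
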